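import Literature.Probability.Percolation.ArmExponentsFourArmEventualBounds
import Literature.Probability.Percolation.AltFourArm
import HarnessLib

/-!
# The four-arm exponent through the alternating event: colour switching isolated as one comparability

Topic `Literature/Probability/Percolation`; family `crit-perc`. Fourth proof-only companion of
`ArmExponents.lean` for the named fact `Literature.Probability.Percolation.fourArm_exponent`
(S. Smirnov, W. Werner, *Critical exponents for two-dimensional percolation*, Math. Res. Lett. 8
(2001) 729–744 = arXiv `math/0109120`, Thm. 4 for `j = 4`: `b₄(r, R) = R^{-5/4 + o(1)}`), after
`ArmExponentsFourArm.lean`, `ArmExponentsFourArmProofs.lean` and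
`ArmExponentsFourArmEventualBounds.lean` (`fourArm_exponent_of_eventualBounds_crit`: eventual
upper/lower bounds for `π₄(4σ, Kσ)` at fixed ratio with exponent `5/4` + quasi-multiplicativity
of `π₄` at `p = 1/2` ⇒ `fourArm_exponent`).

The point of this file. The tree's four-arm event `armEvent ![true, false, true, false] r R`
(whose `P_{1/2}`-probability is `π₄ = critFourArmProb`) does not prescribe the cyclic order of
the colours: it is the union of the ALTERNATING arrangement (open, closed, open, closed around the
annulus — the event of Kesten 1987 (1.12), Nolin 2008 §4.1 `σ = BWBW`, Werner 2009 `π̂`, now in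
the tree in cluster form as `altFourArm r R`, `AltFourArm.lean`) and the ADJACENT arrangement
(open, open, closed, closed). Only the alternating event has a clean description in the scaling
limit (at least two open and at least two closed crossing clusters of the annulus, i.e. at least
four interface traversals — the event the exploration process / the Camia–Newman loop ensemble
sees, Smirnov–Werner §4.1 and Remark 6); the adjacent arrangement is compared with it by the
colour-switching argument (Smirnov–Werner, paragraph before Thm. 4: "One can also prescribe
colours of the crossings and their order, which will change `b_j` up to a multiplicative constant
(we will justify this rigorously later)"; Nolin 2008, §5.1; Aizenman–Duplantier–Aharony 1999),
which is a separate, purely discrete statement at `p = 1/2`. This file therefore re-threads the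
reduction of `fourArm_exponent` through the alternating probabilities
`a(r, R) = altFourArmProbAt half r R = P_{1/2}(altFourArm r R)`, so that the continuum input is
asked of the alternating event only and colour switching enters as ONE explicit comparability
hypothesis `π₄(r, R) ≤ C · a(r, R)` (`n₁ ≤ r ≤ R`), used only through the insensitivity of
logarithmic exponents to constant factors:

* `tendsto_log_const_mul_div_log` — `log (C·g(K)) / log K` has the same limit as
  `log g(K) / log K` (`C > 0`; also when `g` vanishes, `Real.log 0 = 0`).
* `hasDecayExponent_of_comparable` — a sequence squeezed between `c·v` and `C·v` (eventually,
  `v` eventually positive) has the decay exponent of `v`.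
* `fourArm_exponent_of_alt_hasDecayExponent` — **last step of the all-alternating architecture**:
  IF the alternating probabilities `a(r₀, ·)` have decay exponent `5/4` for all large `r₀` (Nolin
  2008, Thm. 22 for `σ = BWBW`; Werner 2009, Lecture 5, Thm. 5.2) and `π₄ ≤ C·a` (colour
  switching), THEN `fourArm_exponent` (`a ≤ π₄` is `altFourArmProbAt_le_fourArmProbAt`).
* `fourArm_exponent_of_eventualBounds_alt_crit` — **the portmanteau-ready reduction with the
  continuum input on the alternating event**: eventual bounds
  `limsup_σ a(4σ, Kσ) ≤ g⁺(K)`, `g⁻(K) ≤ liminf_σ a(4σ, Kσ)` with `log g^±(K) / log K → -5/4`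
  (Smirnov–Werner (16) with (9), (13)–(15): radial `SLE₆` derivative exponent `ν(1) = 5/4` of
  Lawler–Schramm–Werner, Acta Math. 187 (2001)), colour switching `π₄ ≤ C·a`, and the
  quasi-multiplicativity of `π₄` at `p = 1/2` (SW (10); the shape delivered by
  `critFourArmProb_quasiMult_of_separation`) imply `fourArm_exponent`; the upper eventual bound
  is transferred to `π₄` with `g⁺ ↦ C·g⁺`, the lower one through `a ≤ π₄`.
* `fourArm_exponent_of_eventualBounds_alt` — the same with the quasi-multiplicativity read off
  from the named fact `Werner2009_fourArm_quasiMult` (`critFourArmProb_quasiMult_of_fact`).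

Appended (the all-alternating assembly, so that quasi-multiplicativity too can be asked of the
alternating event and colour switching is used exactly once, at the end):

* `altFourArmProbAt_submult` — (C) sub-multiplicativity of `a_t(r, R) = P_t(altFourArm r R)`
  across adjacent annuli (independence; as `polyArmProb_submult`).
* `altFourArmProbAt_half_pos` — (E) `P_{1/2}(altFourArm r R) > 0` for `1 ≤ r ≤ R` (the
  configuration equal on the annulus to the double cone `2|x₁| < |x₀|`: the four axis rays are
  alternating arms and the two separation clauses hold by sign invariants along lattice paths,
  `AltFourArmPos.pos_fst_of_pathIn`, `AltFourArmPos.pos_snd_of_pathIn`).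
* `altFourArm_hasDecayExponent_of_scaleBounds`, `altFourArm_hasDecayExponent_of_eventualBounds`
  — the product-of-scales assembly run for `a` itself: scale bounds (or eventual bounds) with
  exponent `5/4` + quasi-multiplicativity of `a` at `p = 1/2` ⇒ `log a(r₀, R) / log R → -5/4`
  for all large `r₀`.
* `fourArm_exponent_of_alt_eventualBounds_of_altQuasiMult` — eventual bounds for `a` +
  quasi-multiplicativity of `a` + colour switching `π₄ ≤ C·a` ⇒ `fourArm_exponent`.

Everything here is proved; no definition and no named fact is introduced (D-0026). What remains
for `fourArm_exponent_holds` is unchanged in substance and now itemised as: (I) four-arm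
separation / quasi-multiplicativity at `p = 1/2`; (I′) colour switching `π₄ ≤ C·a` at `p = 1/2`;
(II) the eventual bounds for the ALTERNATING event against closed/open continuum events under the
scaling limit (Smirnov; Camia–Newman); (III) the exponent `5/4` of those continuum probabilities
(Lawler–Schramm–Werner 2001, radial `SLE₆`).

## References

* S. Smirnov, W. Werner, Math. Res. Lett. 8 (2001) 729–744; arXiv:math/0109120, Thm. 4 (`j = 4`),
  the paragraph before it (prescribed colours and order), §4 (9), (10), (16), Remark 6
  [SmirnovWernerMRL2001].
* P. Nolin, *Near-critical percolation in two dimensions*, Electron. J. Probab. 13 (2008)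
  1562–1623, §4.1 (`A_{j,σ}`), §5.1 (colour exchange), Thm. 22 (arm exponents)
  (arXiv 0711.4948) [Nolin2008].
* G. F. Lawler, O. Schramm, W. Werner, *Values of Brownian intersection exponents II: Plane
  exponents*, Acta Math. 187 (2001) 275–308 [LawlerSchrammWerner2001PlaneExponents].
* W. Werner, *Lectures on two-dimensional critical percolation*, PCMI 2009, Lecture 5 Thm. 5.2,
  Lecture 6 §4 and Cor. 6.2 [WernerPCMI2009].

Mathlib: `Real.log_mul`, `Real.log_zero`, `Real.log_le_log_iff`, `Real.tendsto_log_atTop`,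
`Filter.Tendsto.div_atTop`, `squeeze_zero_norm'`, `tendsto_of_tendsto_of_tendsto_of_le_of_le'`.
Tree: `fourArm_exponent_of_eventualBounds_crit` (`ArmExponentsFourArmEventualBounds.lean`),
`critFourArmProb_quasiMult_of_fact` (`ArmExponentsFourArm.lean`), `altFourArmProbAt`,
`altFourArmProbAt_le_fourArmProbAt`, `altFourArmProbAt_nonneg` (`AltFourArm.lean`),
`fourArmProbAt_half` (`WernerPivotalEstimates.lean`), `hasDecayExponent_eventually_pos`
(`KestenScaling.lean`), `HasDecayExponent`, `HasArmExponent`, `critFourArmProb`; for the appended part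
`ArmExponentAssembly.hasDecayExponent_of_scales`, `FourArmPos.*` (rays; `ArmExponentsFourArm.lean`),
`TwoArmPos.triSitePercolation_half_cylinder_pos`, `sitePercolation_inter_of_determined`, `triAnnulus`
(`ArmEventsProofs.lean`), `altFourArm_anti`, `altFourArm_mono_left`, `altFourArm_determined`,
`altFourArmProbAt_anti` (`AltFourArm.lean`), `triGraph_adj_apply` (`TriangularLatticeProofs.lean`), `PathIn`.
-/

noncomputable section

open Filter
open _root_.Topology

namespace Literature.Probability.Percolation

open LatticeModels

/-! ### Logarithmic exponents ignore constant factors -/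

/-- `|log (C x) - log x| ≤ |log C|` for `C > 0` and every real `x` (equality `log (Cx) = log C +
log x` if `x ≠ 0`; both logarithms vanish if `x = 0`). [folklore] -/
theorem abs_log_const_mul_sub_log_le {C : ℝ} (hC : 0 < C) (x : ℝ) :
    |Real.log (C * x) - Real.log x| ≤ |Real.log C| := by
  rcases eq_or_ne x 0 with rfl | hx
  · simp
  · rw [Real.log_mul hC.ne' hx, add_sub_cancel_right]

/-- **Constant factors do not change logarithmic exponents**: if `log g(K) / log K → a` along the
integers then `log (C · g(K)) / log K → a` for every constant `C > 0` (the difference is at most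
`|log C| / log K → 0`). [folklore] -/
theorem tendsto_log_const_mul_div_log {g : ℕ → ℝ} {a C : ℝ} (hC : 0 < C)
    (h : Tendsto (fun K : ℕ => Real.log (g K) / Real.log K) atTop (𝓝 a)) :
    Tendsto (fun K : ℕ => Real.log (C * g K) / Real.log K) atTop (𝓝 a) := by
  have hlog : Tendsto (fun K : ℕ => Real.log (K : ℝ)) atTop atTop :=
    Real.tendsto_log_atTop.comp tendsto_natCast_atTop_atTop
  -- the correction term tends to `0`
  have hd : Tendsto (fun K : ℕ => (Real.log (C * g K) - Real.log (g K)) / Real.log K) atTop (𝓝 0) := by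
    have hbound : Tendsto (fun K : ℕ => |Real.log C| / Real.log (K : ℝ)) atTop (𝓝 0) :=
      tendsto_const_nhds.div_atTop hlog
    refine squeeze_zero_norm' ?_ hbound
    filter_upwards [hlog.eventually_gt_atTop 0] with K hK
    rw [Real.norm_eq_abs, abs_div, abs_of_pos hK]
    exact div_le_div_of_nonneg_right (abs_log_const_mul_sub_log_le hC (g K)) hK.le
  have hsum := h.add hd
  rw [add_zero] at hsum
  refine hsum.congr' ?_
  filter_upwards [hlog.eventually_gt_atTop 0] with K hK
  field_simp
  ring

/-- **Comparable sequences have the same decay exponent.** If `v` is eventually positive with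
`log v(n) / log n → -κ` and `c · v(n) ≤ u(n) ≤ C · v(n)` eventually (`c, C > 0`), then
`log u(n) / log n → -κ`. (The form in which "changes `b_j` up to a multiplicative constant,
preserving the theorem" is used, Smirnov–Werner 2001, before Thm. 4.) [folklore] -/
theorem hasDecayExponent_of_comparable {u v : ℕ → ℝ} {κ c C : ℝ} (hc : 0 < c) (hC : 0 < C)
    (hv : ∀ᶠ n in atTop, 0 < v n) (hle : ∀ᶠ n in atTop, c * v n ≤ u n)
    (hge : ∀ᶠ n in atTop, u n ≤ C * v n) (h : HasDecayExponent v κ) : HasDecayExponent u κ := by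
  unfold HasDecayExponent at h ⊢
  have hlog : Tendsto (fun n : ℕ => Real.log (n : ℝ)) atTop atTop :=
    Real.tendsto_log_atTop.comp tendsto_natCast_atTop_atTop
  have hlow := tendsto_log_const_mul_div_log hc h
  have hup := tendsto_log_const_mul_div_log hC h
  refine tendsto_of_tendsto_of_tendsto_of_le_of_le' hlow hup ?_ ?_
  · filter_upwards [hv, hle, hlog.eventually_gt_atTop 0] with n hvn hlen hlogn
    have hcv : 0 < c * v n := mul_pos hc hvn
    exact div_le_div_of_nonneg_right ((Real.log_le_log_iff hcv (hcv.trans_le hlen)).2 hlen) hlogn.le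
  · filter_upwards [hv, hle, hge, hlog.eventually_gt_atTop 0] with n hvn hlen hgen hlogn
    have hcv : 0 < c * v n := mul_pos hc hvn
    exact div_le_div_of_nonneg_right ((Real.log_le_log_iff (hcv.trans_le hlen) (mul_pos hC hvn)).2 hgen)
      hlogn.le

/-! ### The last step of the all-alternating architecture -/

/-- **The four-arm exponent from the exponent of the alternating event and colour switching**
(Smirnov–Werner 2001, Thm. 4 for `j = 4` together with the paragraph before it: prescribing the
colours and their cyclic order changes `b_j` by at most a multiplicative constant, hence preserves
the exponent; colour exchange: Nolin 2008, §5.1). IF for every large inner radius `r₀` the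
alternating four-arm probabilities `a(r₀, R) = P_{1/2}(altFourArm r₀ R)` satisfy
`log a(r₀, R) / log R → -5/4` (Nolin 2008, Thm. 22 with `σ = BWBW`; Werner 2009, Lecture 5,
Thm. 5.2), and IF `π₄(r, R) ≤ C · a(r, R)` for `n₁ ≤ r ≤ R` (colour switching at `p = 1/2`;
the other inequality `a ≤ π₄` is `altFourArmProbAt_le_fourArmProbAt`), THEN `fourArm_exponent`.
[cite: SmirnovWernerMRL2001, Thm. 4 (j = 4) and the paragraph before it (prescribed colours and order)] [cite: Nolin2008, §5.1 and Thm. 22 (arXiv 0711.4948)] -/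
theorem fourArm_exponent_of_alt_hasDecayExponent
    (halt : ∃ r₁ : ℕ, ∀ r₀ ≥ r₁, HasDecayExponent (fun R => altFourArmProbAt half r₀ R) (5 / 4))
    (hcmp : ∃ C : ℝ, 0 < C ∧ ∃ n₁ : ℕ, ∀ ⦃r R : ℕ⦄, n₁ ≤ r → r ≤ R →
      critFourArmProb r R ≤ C * altFourArmProbAt half r R) :
    fourArm_exponent := by
  obtain ⟨r₁, halt⟩ := halt
  obtain ⟨C, hC, n₁, hcmp⟩ := hcmp
  refine ⟨max r₁ n₁, fun r₀ hr₀ => ?_⟩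
  have hr₁ : r₁ ≤ r₀ := le_trans (le_max_left _ _) hr₀
  have hn₁ : n₁ ≤ r₀ := le_trans (le_max_right _ _) hr₀
  have ha := halt r₀ hr₁
  have hpos : ∀ᶠ R : ℕ in atTop, 0 < altFourArmProbAt half r₀ R :=
    hasDecayExponent_eventually_pos ha (by norm_num) fun R => altFourArmProbAt_nonneg half r₀ R
  unfold HasArmExponent
  refine hasDecayExponent_of_comparable (c := 1) one_pos hC hpos ?_ ?_ ha
  · filter_upwards with R
    rw [one_mul]
    simpa only [fourArmProbAt_half] using altFourArmProbAt_le_fourArmProbAt half r₀ R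
  · filter_upwards [eventually_ge_atTop r₀] with R hR
    exact hcmp hn₁ hR

/-! ### The portmanteau-ready reduction with the continuum input on the alternating event -/

/-- **The four-arm exponent from eventual bounds for the ALTERNATING event, colour switching and
quasi-multiplicativity at `p = 1/2`** (Smirnov–Werner 2001, Thm. 4 for `j = 4`, from the two
observations of §4). IF for every integer ratio `K > 4` the alternating probabilities
`a(4σ, Kσ) = P_{1/2}(altFourArm (4σ) (Kσ))` are eventually below every `u > g⁺(K)` and eventually
above every `l < g⁻(K)` (SW (16) in portmanteau form: `limsup`/`liminf` against the probabilities
`g⁺(K)`, `g⁻(K) ≥ 0` of a closed, resp. open, continuum event sandwiching the image of the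
alternating event under the scaling limit), where `log g^±(K) / log K → -5/4` (SW (9) with
(13)–(15): radial `SLE₆` derivative exponent `ν(1) = 5/4`, Lawler–Schramm–Werner 2001), IF
`π₄(r, R) ≤ C · a(r, R)` for `n₁ ≤ r ≤ R` (colour switching, SW before Thm. 4; Nolin 2008 §5.1),
and IF `π₄` is quasi-multiplicative at `p = 1/2` (SW (10); Kesten 1987), THEN `fourArm_exponent`.
Proof: `fourArm_exponent_of_eventualBounds_crit` with the upper function `C · g⁺`
(`tendsto_log_const_mul_div_log`) and the lower bound transported along `a ≤ π₄`. [cite: SmirnovWernerMRL2001, Thm. 4 (j = 4), §4 (9), (10), (16) and the paragraph before Thm. 4] [cite: Nolin2008, §5.1 (arXiv 0711.4948)] -/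
theorem fourArm_exponent_of_eventualBounds_alt_crit (gl gu : ℕ → ℝ)
    (hgl : ∀ K : ℕ, 4 < K → 0 ≤ gl K)
    (hup : ∀ K : ℕ, 4 < K → ∀ u : ℝ, gu K < u →
      ∀ᶠ σ : ℕ in atTop, altFourArmProbAt half (σ * 4) (σ * K) < u)
    (hlow : ∀ K : ℕ, 4 < K → ∀ l : ℝ, l < gl K →
      ∀ᶠ σ : ℕ in atTop, l < altFourArmProbAt half (σ * 4) (σ * K))
    (hexpu : Tendsto (fun K : ℕ => Real.log (gu K) / Real.log K) atTop (𝓝 (-(5 / 4))))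
    (hexpl : Tendsto (fun K : ℕ => Real.log (gl K) / Real.log K) atTop (𝓝 (-(5 / 4))))
    (hcmp : ∃ C : ℝ, 0 < C ∧ ∃ n₁ : ℕ, ∀ ⦃r R : ℕ⦄, n₁ ≤ r → r ≤ R →
      critFourArmProb r R ≤ C * altFourArmProbAt half r R)
    (hB : ∃ n₀ : ℕ, ∃ c > (0 : ℝ), ∀ ⦃r R S : ℕ⦄, n₀ ≤ r → 16 * r < 4 * R → 4 * R < S →
      c * (critFourArmProb r R * critFourArmProb (4 * R) S) ≤ critFourArmProb r S) :
    fourArm_exponent := by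
  obtain ⟨C, hC, n₁, hcmp⟩ := hcmp
  refine fourArm_exponent_of_eventualBounds_crit gl (fun K => C * gu K) hgl ?_ ?_
    (tendsto_log_const_mul_div_log hC hexpu) hexpl hB
  · intro K hK u hu
    have hu' : gu K < u / C := by rwa [lt_div_iff₀ hC, mul_comm]
    filter_upwards [hup K hK _ hu', eventually_ge_atTop n₁] with σ hσ hσn
    have h4 : n₁ ≤ σ * 4 := le_trans hσn (Nat.le_mul_of_pos_right σ (by norm_num))
    have hle : σ * 4 ≤ σ * K := Nat.mul_le_mul_left σ (by omega)
    have hlt : C * altFourArmProbAt half (σ * 4) (σ * K) < u := by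
      rw [mul_comm]
      exact (lt_div_iff₀ hC).1 hσ
    exact (hcmp h4 hle).trans_lt hlt
  · intro K hK l hl
    filter_upwards [hlow K hK l hl] with σ hσ
    refine hσ.trans_le ?_
    simpa only [fourArmProbAt_half] using altFourArmProbAt_le_fourArmProbAt half (σ * 4) (σ * K)

/-- **The same with `Werner2009_fourArm_quasiMult`**: eventual bounds for the alternating event,
colour switching `π₄ ≤ C · a`, and the tree's near-critical quasi-multiplicativity fact read at
`t = 1/2` (`critFourArmProb_quasiMult_of_fact`; Werner 2009, Lecture 6, Cor. 6.2) imply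
`fourArm_exponent`. [cite: SmirnovWernerMRL2001, Thm. 4 (j = 4), §4 (9), (10), (16)] [cite: WernerPCMI2009, Lecture 6, Cor. 6.2] -/
theorem fourArm_exponent_of_eventualBounds_alt (gl gu : ℕ → ℝ)
    (hgl : ∀ K : ℕ, 4 < K → 0 ≤ gl K)
    (hup : ∀ K : ℕ, 4 < K → ∀ u : ℝ, gu K < u →
      ∀ᶠ σ : ℕ in atTop, altFourArmProbAt half (σ * 4) (σ * K) < u)
    (hlow : ∀ K : ℕ, 4 < K → ∀ l : ℝ, l < gl K →
      ∀ᶠ σ : ℕ in atTop, l < altFourArmProbAt half (σ * 4) (σ * K))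
    (hexpu : Tendsto (fun K : ℕ => Real.log (gu K) / Real.log K) atTop (𝓝 (-(5 / 4))))
    (hexpl : Tendsto (fun K : ℕ => Real.log (gl K) / Real.log K) atTop (𝓝 (-(5 / 4))))
    (hcmp : ∃ C : ℝ, 0 < C ∧ ∃ n₁ : ℕ, ∀ ⦃r R : ℕ⦄, n₁ ≤ r → r ≤ R →
      critFourArmProb r R ≤ C * altFourArmProbAt half r R)
    (hB : Werner2009_fourArm_quasiMult) : fourArm_exponent :=
  fourArm_exponent_of_eventualBounds_alt_crit gl gu hgl hup hlow hexpu hexpl hcmp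
    (critFourArmProb_quasiMult_of_fact hB)

open _root_.MeasureTheory

/-! ### Elementary inputs for the alternating probabilities: sub-multiplicativity and positivity

With these, the abstract product-of-scales assembly `ArmExponentAssembly.hasDecayExponent_of_scales`
runs for `a(r, R) = P_{1/2}(altFourArm r R)` itself, so that quasi-multiplicativity can be asked of
the ALTERNATING event (Nolin 2008, Prop. 12/17 for the single colour sequence `σ = BWBW`, which is
what arm separation gives without any colour switching) and colour switching is needed exactly
once, at the very end (`fourArm_exponent_of_alt_hasDecayExponent`). -/

/-- **Sub-multiplicativity of the alternating four-arm probabilities** (independence of disjoint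
annuli): for `n₁ ≤ n₂ < n₃`, `a_t(n₁, n₃) ≤ a_t(n₁, n₂) · a_t(n₂ + 1, n₃)`, since
`altFourArm n₁ n₃ ⊆ altFourArm n₁ n₂ ∩ altFourArm (n₂ + 1) n₃` (`altFourArm_anti`,
`altFourArm_mono_left`) and the two events are determined by the disjoint site sets
`triAnnulus n₁ n₂`, `triAnnulus (n₂ + 1) n₃` (`altFourArm_determined`), exactly as
`polyArmProb_submult`. [cite: SmirnovWernerMRL2001, §4.2 proof of (10)] [cite: Nolin2008, Prop. 17 (arXiv 0711.4948: Prop. 16)] -/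
theorem altFourArmProbAt_submult (t : unitInterval) {n₁ n₂ n₃ : ℕ} (h₁₂ : n₁ ≤ n₂) (h₂₃ : n₂ < n₃) :
    altFourArmProbAt t n₁ n₃ ≤ altFourArmProbAt t n₁ n₂ * altFourArmProbAt t (n₂ + 1) n₃ := by
  classical
  have hsub : altFourArm n₁ n₃ ⊆ altFourArm n₁ n₂ ∩ altFourArm (n₂ + 1) n₃ := fun ω hω =>
    ⟨altFourArm_anti n₁ h₁₂ h₂₃.le hω, altFourArm_mono_left (by omega) (by omega) hω⟩
  have hdisj : Disjoint (triAnnulus n₁ n₂) (triAnnulus (n₂ + 1) n₃) := by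
    rw [Finset.disjoint_left]
    intro v hv hv'
    rw [mem_triAnnulus] at hv hv'
    push_cast at hv'
    omega
  have hprod := sitePercolation_inter_of_determined (V := Site 2) t hdisj
    (altFourArm_determined h₁₂) (altFourArm_determined (Nat.succ_le_of_lt h₂₃))
  unfold altFourArmProbAt LatticeModels.triSitePercolation
  calc (sitePercolation (Site 2) t).real (altFourArm n₁ n₃)
      ≤ (sitePercolation (Site 2) t).real (altFourArm n₁ n₂ ∩ altFourArm (n₂ + 1) n₃) :=
        measureReal_mono hsub
    _ = (sitePercolation (Site 2) t).real (altFourArm n₁ n₂) *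
          (sitePercolation (Site 2) t).real (altFourArm (n₂ + 1) n₃) := by
        rw [measureReal_def, hprod, ENNReal.toReal_mul, ← measureReal_def, ← measureReal_def]

namespace AltFourArmPos

/-- One step of `𝕋` inside the double cone `2|x₁| < |x₀|` cannot cross from `x₀ > 0` to
`x₀ ≤ 0`: the first coordinate changes by at most one along an edge (`triGraph_adj_apply`) and
does not vanish in the cone. [folklore] -/
theorem pos_fst_of_adj {a b : Site 2} (hab : triGraph.Adj a b) (ha : 0 < a 0)
    (hb : 2 * |b 1| < |b 0|) : 0 < b 0 := by
  have hb0 : b 0 ≠ 0 := by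
    intro h
    rw [h, abs_zero] at hb
    linarith [abs_nonneg (b 1)]
  have hge : a 0 - 1 ≤ b 0 := by
    rcases triGraph_adj_apply hab with h | h | h | h | h | h <;> omega
  omega

/-- One step of `𝕋` outside the double cone and off the origin cannot cross from `x₁ > 0` to
`x₁ ≤ 0`: the second coordinate changes by at most one along an edge, and a site with `x₁ = 0`
outside the cone `2|x₁| < |x₀|` is the origin, which has graph norm `0`. [folklore] -/
theorem pos_snd_of_adj {a b : Site 2} (hab : triGraph.Adj a b) (ha : 0 < a 1)
    (hb : ¬ 2 * |b 1| < |b 0|) (hb1 : 1 ≤ triNorm b) : 0 < b 1 := by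
  have hb10 : b 1 ≠ 0 := by
    intro h
    rw [h, abs_zero, mul_zero, not_lt] at hb
    have h0 : b 0 = 0 := abs_nonpos_iff.1 hb
    have : triNorm b = 0 := by simp [triNorm, h, h0]
    omega
  have hge : a 1 - 1 ≤ b 1 := by
    rcases triGraph_adj_apply hab with h | h | h | h | h | h <;> omega
  omega

/-- A path of `𝕋` inside a set of sites of the double cone `2|x₁| < |x₀|` that starts at a site with
`x₀ > 0` only visits sites with `x₀ > 0`. [folklore] -/
theorem pos_fst_of_pathIn {A : Set (Site 2)} (hA : ∀ v ∈ A, 2 * |v 1| < |v 0|) {u v : Site 2}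
    (h : PathIn triGraph A u v) (hu : 0 < u 0) : 0 < v 0 := by
  obtain ⟨-, h⟩ := h
  induction h with
  | refl => exact hu
  | tail _ hbc ih => exact pos_fst_of_adj hbc.1 ih (hA _ hbc.2)

/-- A path of `𝕋` inside a set of sites off the double cone and of graph norm `≥ 1` that starts at
a site with `x₁ > 0` only visits sites with `x₁ > 0`. [folklore] -/
theorem pos_snd_of_pathIn {A : Set (Site 2)} (hA : ∀ v ∈ A, ¬ 2 * |v 1| < |v 0| ∧ 1 ≤ triNorm v)
    {u v : Site 2} (h : PathIn triGraph A u v) (hu : 0 < u 1) : 0 < v 1 := by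
  obtain ⟨-, h⟩ := h
  induction h with
  | refl => exact hu
  | tail _ hbc ih => exact pos_snd_of_adj hbc.1 ih (hA _ hbc.2).1 (hA _ hbc.2).2

end AltFourArmPos

open FourArmPos AltFourArmPos in
/-- **Positivity of the alternating four-arm probability.** For `1 ≤ r ≤ R`,
`P_{1/2}(altFourArm r R) > 0`: on the cylinder event "a site `v` of the annulus `triAnnulus r R` is
open iff `2|v₁| < |v₀|`" (the configuration equal, on the annulus, to the open double cone around
the first axis) the four rays `{t e₀}`, `{t e₁}`, `{-t e₀}`, `{-t e₁}`, `r ≤ t ≤ R`, of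
`critFourArmProb_pos` are arms of colours open/closed/open/closed, no open path of the annulus
joins the two open rays (the first coordinate keeps its sign inside the double cone,
`pos_fst_of_pathIn`) and no closed path of the annulus joins the two closed rays (the second
coordinate keeps its sign off the cone and off the origin, `pos_snd_of_pathIn`). (Nolin 2008, §4.1:
`A_{j,σ}(n₀(j), N) ≠ ∅` by straight rays; here with the cluster-form separation clauses of
`altFourArm`.) [cite: Nolin2008, §4.1 (n₀(j))] -/
theorem altFourArmProbAt_half_pos {r R : ℕ} (hr : 1 ≤ r) (hrR : r ≤ R) : 0 < altFourArmProbAt half r R := by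
  classical
  obtain ⟨n, rfl⟩ : ∃ n : ℕ, R = r + n := ⟨R - r, by omega⟩
  set κ : Fin 4 → Bool := ![true, false, true, false] with hκ
  -- the four rays, uniformly in `j`
  set W : ∀ j : Fin 4, triGraph.Walk (rayPt (dir j) (sgn j * r)) (rayPt (dir j) (sgn j * r + n * sgn j)) :=
    fun j => rayWalk (dir j) (sgn j) (sgn_eq j) (sgn j * r) n with hW
  -- sites of the rays
  have hmemW : ∀ j, ∀ v ∈ (W j).support, ∃ k : ℕ, k ≤ n ∧ v = rayPt (dir j) (sgn j * ((r : ℤ) + k)) := by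
    intro j v hv
    obtain ⟨k, hk, rfl⟩ := mem_support_rayWalk.1 hv
    exact ⟨k, hk, by congr 1; ring⟩
  -- two rays meet only if they are the same ray
  have hdisj : ∀ j j', ∀ v, v ∈ (W j).support → v ∈ (W j').support → j = j' := by
    intro j j' v hv hv'
    obtain ⟨k, -, rfl⟩ := hmemW j v hv
    obtain ⟨k', -, hkk'⟩ := hmemW j' _ hv'
    have hr1 : (1 : ℤ) ≤ r := by exact_mod_cast hr
    have hne : sgn j * ((r : ℤ) + k) ≠ 0 := by
      rcases sgn_eq j with h | h <;> · rw [h]; intro h0; nlinarith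
    obtain ⟨hd, hs⟩ := rayPt_inj hkk' hne
    rcases sgn_eq j with h | h <;> rcases sgn_eq j' with h' | h'
    · exact eq_of_dir_eq_of_sgn_eq hd (h.trans h'.symm)
    · exfalso; rw [h, h'] at hs; nlinarith
    · exfalso; rw [h, h'] at hs; nlinarith
    · exact eq_of_dir_eq_of_sgn_eq hd (h.trans h'.symm)
  -- the rays lie in the annulus
  have hann : ∀ j, ∀ v ∈ (W j).support, v ∈ triAnnulus r (r + n) := by
    intro j v hv
    obtain ⟨k, hk, rfl⟩ := hmemW j v hv
    rw [mem_triAnnulus, triNorm_ray]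
    constructor
    · linarith
    · exact_mod_cast (by omega : r + k ≤ r + n)
  -- the colour read on the rays: the cone predicate is the colour sequence
  have hcol : ∀ j, ∀ v ∈ (W j).support, (2 * |v 1| < |v 0| ↔ κ j) := by
    intro j v hv
    obtain ⟨k, -, rfl⟩ := hmemW j v hv
    have hrk : (0 : ℤ) < (r : ℤ) + k := by exact_mod_cast (by omega : 0 < r + k)
    fin_cases j <;> simp [hκ, dir, sgn, rayPt, abs_of_pos hrk, hrk] <;> omega
  -- the cylinder event: the annulus coloured by the double cone
  set S : Finset (Site 2) := triAnnulus r (r + n) with hS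
  set b : Site 2 → Prop := fun v => 2 * |v 1| < |v 0| with hb
  have hcyl : {ω : SiteConfig (Site 2) | ∀ v ∈ S, (v ∈ ω ↔ b v)} ⊆ altFourArm r (r + n) := by
    intro ω hω
    simp only [Set.mem_setOf_eq] at hω
    refine ⟨fun j => rayPt (dir j) (sgn j * r), fun j => rayPt (dir j) (sgn j * r + n * sgn j), W,
      fun j => ⟨?_, ?_, isPath_rayWalk _ _ _ _ _, fun v hv => ?_, fun v hv => ?_⟩, ?_, ?_, ?_⟩
    · rw [mem_triSphere_iff]
      have := triNorm_ray j r 0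
      simpa using this
    · rw [mem_triSphere_iff]
      have := triNorm_ray j r n
      rw [show sgn j * ((r : ℤ) + n) = sgn j * r + n * sgn j by ring] at this
      rw [this]
      push_cast
      ring
    · obtain ⟨k, hk, rfl⟩ := hmemW j v hv
      rcases Nat.eq_zero_or_pos k with rfl | hk0
      · right
        rw [mem_triSphere_iff, triNorm_ray]
        simp
      · left
        simp only [Set.mem_sdiff, Finset.mem_coe, mem_triBall_iff, triNorm_ray, not_le]
        constructor
        · push_cast; linarith
        · exact_mod_cast Nat.lt_add_of_pos_right hk0
    · rw [hω v (hann j v hv)]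
      exact hcol j v hv
    · intro i j hij
      exact Finset.disjoint_left.2 fun v hvi hvj =>
        hij (hdisj i j v (List.mem_toFinset.1 hvi) (List.mem_toFinset.1 hvj))
    · -- no open path of the annulus joins the two open rays
      intro u hu v hv hpath
      obtain ⟨k, -, rfl⟩ := hmemW 0 u hu
      obtain ⟨k', -, rfl⟩ := hmemW 2 v hv
      have hrk : (0 : ℤ) < (r : ℤ) + k := by exact_mod_cast (by omega : 0 < r + k)
      have hrk' : (0 : ℤ) < (r : ℤ) + k' := by exact_mod_cast (by omega : 0 < r + k')
      have hA : ∀ a ∈ triAnn r (r + n) ∩ ω, 2 * |a 1| < |a 0| := fun a ha =>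
        (hω a (Finset.mem_coe.1 ha.1)).1 ha.2
      have h1 := pos_fst_of_pathIn hA hpath (by simp [dir, sgn, rayPt, hrk])
      simp [dir, sgn, rayPt] at h1
      omega
    · -- no closed path of the annulus joins the two closed rays
      intro u hu v hv hpath
      obtain ⟨k, -, rfl⟩ := hmemW 1 u hu
      obtain ⟨k', -, rfl⟩ := hmemW 3 v hv
      have hrk : (0 : ℤ) < (r : ℤ) + k := by exact_mod_cast (by omega : 0 < r + k)
      have hrk' : (0 : ℤ) < (r : ℤ) + k' := by exact_mod_cast (by omega : 0 < r + k')
      have hA : ∀ a ∈ triAnn r (r + n) \ ω, ¬ 2 * |a 1| < |a 0| ∧ 1 ≤ triNorm a := by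
        intro a ha
        have haS : a ∈ S := Finset.mem_coe.1 ha.1
        refine ⟨fun hba => ha.2 ((hω a haS).2 hba), ?_⟩
        have := (mem_triAnnulus.1 haS).1
        have hr1 : (1 : ℤ) ≤ r := by exact_mod_cast hr
        linarith
      have h1 := pos_snd_of_pathIn hA hpath (by simp [dir, sgn, rayPt, hrk])
      simp [dir, sgn, rayPt] at h1
      omega
  calc (0 : ℝ) < (triSitePercolation half).real {ω : SiteConfig (Site 2) | ∀ v ∈ S, (v ∈ ω ↔ b v)} :=
        TwoArmPos.triSitePercolation_half_cylinder_pos S b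
    _ ≤ altFourArmProbAt half r (r + n) := by
        unfold altFourArmProbAt
        exact measureReal_mono hcyl

/-! ### The all-alternating assembly -/

/-- **The exponent of the alternating event from its scale bounds and its quasi-multiplicativity**
(the product-of-scales assembly `ArmExponentAssembly.hasDecayExponent_of_scales`, Smirnov–Werner
2001 p. 5 and §4, run for `a(r, R) = P_{1/2}(altFourArm r R)` with (C) `altFourArmProbAt_submult`,
(D) `altFourArmProbAt_anti`, (E) `altFourArmProbAt_half_pos`). IF the two-sided scale bounds
`K^{-5/4-ε} ≤ a(4σ, Kσ) ≤ K^{-5/4+ε}` hold for all large `K` and then all large `σ` (SW (16) with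
(9)) and `a` is quasi-multiplicative at `p = 1/2` in the gapped form
`c · a(r, R) · a(4R, S) ≤ a(r, S)` (`n₀ ≤ r`, `16 r < 4R < S`; Nolin 2008, Prop. 17 with Prop. 12
for `σ = BWBW`; Werner 2009, Lecture 6, Cor. 6.2), THEN `log a(r₀, R) / log R → -5/4` for every
`r₀ ≥ max 1 n₀`. [cite: SmirnovWernerMRL2001, §4 (9), (10), (16) and p. 5] [cite: Nolin2008, Prop. 17 with Prop. 12 (arXiv 0711.4948: Prop. 16, Prop. 11)] -/
theorem altFourArm_hasDecayExponent_of_scaleBounds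
    (hA : ∀ ε : ℝ, 0 < ε → ∀ᶠ K : ℕ in atTop, ∀ᶠ σ : ℕ in atTop,
      (K : ℝ) ^ (-(5 / 4 : ℝ) - ε) ≤ altFourArmProbAt half (σ * 4) (σ * K) ∧
        altFourArmProbAt half (σ * 4) (σ * K) ≤ (K : ℝ) ^ (-(5 / 4 : ℝ) + ε))
    (hB : ∃ n₀ : ℕ, ∃ c > (0 : ℝ), ∀ ⦃r R S : ℕ⦄, n₀ ≤ r → 16 * r < 4 * R → 4 * R < S →
      c * (altFourArmProbAt half r R * altFourArmProbAt half (4 * R) S) ≤ altFourArmProbAt half r S) :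
    ∃ r₁ : ℕ, ∀ r₀ ≥ r₁, HasDecayExponent (fun R => altFourArmProbAt half r₀ R) (5 / 4) := by
  obtain ⟨n₀, c, hc, hqm⟩ := hB
  refine ⟨max 1 n₀, fun r₀ hr₀ => ?_⟩
  have hr₀1 : 1 ≤ r₀ := le_trans (le_max_left _ _) hr₀
  have hr₀n : n₀ ≤ r₀ := le_trans (le_max_right _ _) hr₀
  exact ArmExponentAssembly.hasDecayExponent_of_scales (fun r R => altFourArmProbAt half r R)
    (fun r R => altFourArmProbAt_nonneg half r R) (fun r R => altFourArmProbAt_le_one half r R)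
    (fun r R R' hr hR => altFourArmProbAt_anti half r hr hR)
    (fun n₁ n₂ n₃ h₁₂ h₂₃ => altFourArmProbAt_submult half h₁₂ h₂₃)
    (fun r R hr hR => altFourArmProbAt_half_pos hr hR) hc hqm (by norm_num) hA hr₀1 hr₀n

/-- **The exponent of the alternating event from eventual bounds and its quasi-multiplicativity**:
the same with the scale bounds obtained from the portmanteau-shaped eventual bounds
`limsup_σ a(4σ, Kσ) ≤ g⁺(K)`, `g⁻(K) ≤ liminf_σ a(4σ, Kσ)`, `log g^±(K) / log K → -5/4`
(`ArmExponentAssembly.scaleBounds_of_eventualBounds`). [cite: SmirnovWernerMRL2001, §4 (9), (10), (16)] -/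
theorem altFourArm_hasDecayExponent_of_eventualBounds (gl gu : ℕ → ℝ)
    (hgl : ∀ K : ℕ, 4 < K → 0 ≤ gl K)
    (hup : ∀ K : ℕ, 4 < K → ∀ u : ℝ, gu K < u →
      ∀ᶠ σ : ℕ in atTop, altFourArmProbAt half (σ * 4) (σ * K) < u)
    (hlow : ∀ K : ℕ, 4 < K → ∀ l : ℝ, l < gl K →
      ∀ᶠ σ : ℕ in atTop, l < altFourArmProbAt half (σ * 4) (σ * K))
    (hexpu : Tendsto (fun K : ℕ => Real.log (gu K) / Real.log K) atTop (𝓝 (-(5 / 4))))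
    (hexpl : Tendsto (fun K : ℕ => Real.log (gl K) / Real.log K) atTop (𝓝 (-(5 / 4))))
    (hB : ∃ n₀ : ℕ, ∃ c > (0 : ℝ), ∀ ⦃r R S : ℕ⦄, n₀ ≤ r → 16 * r < 4 * R → 4 * R < S →
      c * (altFourArmProbAt half r R * altFourArmProbAt half (4 * R) S) ≤ altFourArmProbAt half r S) :
    ∃ r₁ : ℕ, ∀ r₀ ≥ r₁, HasDecayExponent (fun R => altFourArmProbAt half r₀ R) (5 / 4) :=
  altFourArm_hasDecayExponent_of_scaleBounds
    (ArmExponentAssembly.scaleBounds_of_eventualBounds (fun r R => altFourArmProbAt half r R) gl gu hgl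
      hup hlow (by norm_num) hexpu hexpl) hB

/-- **The four-arm exponent, all-alternating form** (Smirnov–Werner 2001, Thm. 4 for `j = 4`):
eventual upper/lower bounds for the alternating event at fixed ratio with exponent `5/4` (the
scaling limit and its `SLE₆` exponent, SW (16) with (9)), quasi-multiplicativity of the
ALTERNATING probabilities at `p = 1/2` (arm separation for `σ = BWBW`, SW (10); Nolin 2008,
Prop. 17), and the colour-switching comparability `π₄ ≤ C · a` (SW, paragraph before Thm. 4;
Nolin 2008, §5.1) imply `fourArm_exponent`. Colour switching is used exactly once, in the last
step `fourArm_exponent_of_alt_hasDecayExponent`. [cite: SmirnovWernerMRL2001, Thm. 4 (j = 4), §4 (9), (10), (16) and the paragraph before Thm. 4] [cite: Nolin2008, Prop. 17 and §5.1 (arXiv 0711.4948: Prop. 16, §5.1)] -/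
theorem fourArm_exponent_of_alt_eventualBounds_of_altQuasiMult (gl gu : ℕ → ℝ)
    (hgl : ∀ K : ℕ, 4 < K → 0 ≤ gl K)
    (hup : ∀ K : ℕ, 4 < K → ∀ u : ℝ, gu K < u →
      ∀ᶠ σ : ℕ in atTop, altFourArmProbAt half (σ * 4) (σ * K) < u)
    (hlow : ∀ K : ℕ, 4 < K → ∀ l : ℝ, l < gl K →
      ∀ᶠ σ : ℕ in atTop, l < altFourArmProbAt half (σ * 4) (σ * K))
    (hexpu : Tendsto (fun K : ℕ => Real.log (gu K) / Real.log K) atTop (𝓝 (-(5 / 4))))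
    (hexpl : Tendsto (fun K : ℕ => Real.log (gl K) / Real.log K) atTop (𝓝 (-(5 / 4))))
    (hB : ∃ n₀ : ℕ, ∃ c > (0 : ℝ), ∀ ⦃r R S : ℕ⦄, n₀ ≤ r → 16 * r < 4 * R → 4 * R < S →
      c * (altFourArmProbAt half r R * altFourArmProbAt half (4 * R) S) ≤ altFourArmProbAt half r S)
    (hcmp : ∃ C : ℝ, 0 < C ∧ ∃ n₁ : ℕ, ∀ ⦃r R : ℕ⦄, n₁ ≤ r → r ≤ R →
      critFourArmProb r R ≤ C * altFourArmProbAt half r R) :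
    fourArm_exponent :=
  fourArm_exponent_of_alt_hasDecayExponent
    (altFourArm_hasDecayExponent_of_eventualBounds gl gu hgl hup hlow hexpu hexpl hB) hcmp

end Literature.Probability.Percolation
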